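import Literature.MathematicalPhysics.QuantumFieldTheory.Balaban1983to89.Node00.CarriersB12FundamentalCase
import Literature.MathematicalPhysics.QuantumFieldTheory.Balaban1983to89.Node00.Record12CarriersB12Package

/-!
# NODE 00 (YM-PLAN Track A) — STAGE 3′(X.B12) COMPANION AT STAGE 12, MODULE C: THE FUNDAMENTAL-CASE INPUTS OF LEMMA 4 AS ONE DISPLAYED RECORD (`B12FundamentalInputs`),
# ITS TRANSPORT TO THE PACKAGE (`toPackage`, the seven region fields DISCHARGED by dag-n09-c's §2), AND THE RE-KEY OF dag-n09-c's FUNDAMENTAL-CASE CLOSERS AT A NAMED λ₁₂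
# OF def-T's `Record12` (ref-G ADDENDUM-ROW24's owed cure): Stage-12 leaf, θ-explicit world faces, proviso-carrying record constructors, and the kernel negatives

NODE 00 COMPANION MODULE (seat `pub-ymgap-node00-def-B12` g3, 2026-08-26; dag-lead DEDUP-209 GO).  APPEND-ONLY: a NEW importing module — dag-n09-c g2's
`Node00/CarriersB12FundamentalCase` (p458455: §1 `IdxB12` geometry, §2 the seven region fields of `B12Package` at the frames of record from `X ⊆ □̃³ ⇐ X ⊆ □̃²`, §3
`b12LeafOfRecord_of_fundamental` ∕ `exists_residB12Run_restrictions`) and this seat's `Node00/Record12CarriersB12Package` (p466268, module A: `B12Provisos`,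
`b12LeafOfRecord₁₂_of_package`, the θ-explicit named-λ₁₂ world faces, `IsRecordOfRecord₁₂CB10YZWB8B12Prov` ∕ `…B8subB12Prov`, the kernel negatives) are CONSUMED BY NAME; no
landed file is touched.

WHY (event of record).  dag-ref-G g2 ADDENDUM-ROW24 (pub-ymgap INBOX l.13386): dag-n09-c's Stage-11 record-level closer `b12_leaf_of_isRecordOfRecord₁₁CB10YZWB8B12_of_fundamental`
(p458455 :398–:451) is VACUOUS OUTRIGHT (its premise `IsRecordOfRecord₁₁CB10YZWB8B12` presents a `θ.Provisos₁₁`, refuted by def-T's `not_provisos₁₁`; module A's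
`not_isRecordOfRecord₁₁CB10YZWB8B12`), and «the closer TRANSPORT must be RE-KEYED at a NAMED λ₁₂ when the ₁₂ carriers land — append-only successor, same pattern as def-B12's
`Record12CarriersB12Package`»; dag-lead DEDUP-184 («def-B12 g2's ₁₂ successor is the cure»).  Module A re-keyed the `_of_package` faces; THIS module re-keys the
FUNDAMENTAL-CASE faces (the package's seven region fields discharged from print's `X ⊂ □̃²` by dag-n09-c's §2), which module A does not carry.

WHAT IS DEFINED ∕ PROVED (kernel bookkeeping, 0 sorry).
* §0 `B12FundamentalInputs Rz cB lam` — a `Type`-valued HYPOTHESIS structure (the `JInputs` carry the [15]-functions as data): EXACTLY the binders of dag-n09-c's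
  `b12LeafOfRecord_of_fundamental` — the fundamental case `X ⊆ □̃²` of the run's instance (site sets), the seven further restrictions on the constants (`Cπ = 2`), THE
  BY-REFERENCE PACKAGE `JInputs` ([15], [14]) for every value of the variables `(𝐔, 𝐀, τ, B′)` in the printed domain, and the analyticity of the letters `𝐊`, `𝐀₂` — i.e.
  `B12Package` with its seven REGION fields REPLACED by the one inclusion `hX`; `toPackage` (the seven region fields := dag-n09-c's §2 theorems at `X ⊆ □̃³ ⇐ X ⊆ □̃²`),
  `ofPackage` (forgetting the regions, given `hX`), `nonempty_iff_nonempty_package`; the faces at the residual layer: `leaf` (= dag-n09-c's `b12LeafOfRecord_of_fundamental`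
  BY NAME), `provisos` (module A's `B12Provisos` from the inputs + «all the restrictions» + `0 ∈ (3.31)`), `lemma4_conclusion` (THE CONCLUSION OF LEMMA 4 OUTRIGHT — (3.53) on
  the printed domain ∧ the analyticity clause — with the restrictions DISPLAYED AND APPLIED, the honest horn of ref-C READ116 (B4)).
* §1 at a Stage-12 parameter: `b12LeafOfRecord₁₂_of_fundamental` (the verbatim ₁₂ twin of dag-n09-c's `b12LeafOfRecord₁₁_of_fundamental`: explicit binders, `0 < O(1)LMB`
  from Stage-12 admissibility), `b12LeafOfRecord₁₂_of_fundamentalInputs` (record-keyed), and the JOINT SATISFIABILITY of the `Prop` binders at every Stage-12 parameter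
  (`exists_residB12_restrictions` ∕ `exists_residB12_restrictions₁₂`: dag-n09-c's `exists_residB12Run_restrictions` run by run, `M = τ9.M ≥ 1` from admissibility, `L ≥ 2`
  from the family) — the binders `hX`, `hB`–`hresJ`, «all the restrictions», `0 ∈ A331` are not an empty conjunction at any record (letters `𝐊 = 𝐀₂ = 0` of the witness are
  JUNK: a witness for the BINDERS, not objects of print).
* §2 the θ-explicit NAMED-λ₁₂ world faces in the fundamental case (`b12_leaf_of_up_view₁₂B12B8B10YZW_of_fundamental`, `…B8subB10YZW_of_fundamental`: module A's `_of_leaf`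
  faces on §0's `leaf`) — ONE named layer `lam12 P`, never «all layers».
* §3 the proviso-carrying successor records of module A BUILT FROM fundamental inputs at every run (`exists_world_isRecordOfRecord₁₂CB10YZWB8B12Prov_of_fundamental`,
  `…B8subB12Prov_of_fundamental`, and `exists_world_b12_of_fundamental`: such a world has `(leavesP w P).b12` at every run, by module A's `b12_leaf_of_…Prov`).
* §4 KERNEL NEGATIVES (display only — consumed by no face above): WHY dag-n09-c's ∀-over-presenting-layers binder shape (:398's `hX hR inputs hKan hA2an`) is NOT re-filed at
  Stage 12 — at every `₁₂C` record the ∀-over-layers FUNDAMENTAL-INPUTS binder type is EMPTY (`isEmpty_forallFundamentalBinder₁₂_of_isRecordOfRecord₁₂C`, through `toPackage`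
  and module A's `isEmpty_forallPackageBinder₁₂_of_isRecordOfRecord₁₂C`) and already the ∀-over-layers RESTRICTION binder `1 ≤ B₃` is FALSE (`not_forallRestrictionBinder₁₂_of_…`:
  module A's zero layer `B₃ := 0` of an inhabitant of g32's `ResidB12`); a closer with such a binder would conclude from `False`.  Hence every face here is keyed on ONE NAMED
  `(θ, λ₁₂)`.

WHAT THIS IS NOT.  Not a discharge of N09 (count-neutral): `B12FundamentalInputs` is a hypothesis — its `inputs` ∕ `hKan` ∕ `hA2an` fields ARE the content of pp. 275–280
([15]'s Landau-gauge functions, the gauge transformations (3.37)–(3.42) with their costs, the identities (3.38) ∕ (3.39) ∕ (3.42), the sizes (3.37), (3.45), (3.50), (J2), (J3))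
for the residual letters `𝐊`, `𝐀₂` of record, which have NO tree object; what the module makes explicit is that, of p07's `Lemma4Data` law-fields, ONLY these remain
displayed once the geometry of print's fundamental case is a theorem (dag-n09-c §2).  Every closer over the §3 records is GAP-STATED(package) BY CONSTRUCTION, and those
records are NOT the world of record (N09's count line lives at def-T's `IsRecordOfRecord₁₂C`; ref-C NOTE-2 (c)(iii)).  READING NOTES inherited unchanged from p07's frame ∕
the companion (ref-C (B5)–(B7), located, not blocking).  HONEST FRAMING: definitions + kernel bookkeeping; NO estimate; nothing of [Balaban1987RG1] ∕ [15] asserted;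
counts unmoved (5∕28); one finite `T⁴` programme at fixed `ε`, Bałaban as printed — NOT continuum ∕ ℝ⁴ ∕ infinite volume ∕ OS ∕ mass gap ∕ Clay.  No `sorry`, no `axiom`,
no `opaque`, no `instance`, no `notation`.  [Balaban1987RG1] = T. Bałaban, *Renormalization group approach to lattice gauge field theories. I*, Commun. Math. Phys. **109**
(1987) 249–301; [15] = [Balaban1985Variational], Commun. Math. Phys. **102** (1985) 277–309; [Balaban1989LargeFieldII] = Commun. Math. Phys. **122** (1989) 355–392. -/

noncomputable section

namespace Literature.MathematicalPhysics.QuantumFieldTheory.Balaban1983to89.Node00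

open T4Continuum AveragingRT T4FiniteEpsInhabited FlowStep FlowStepRuns DagBinding T4DatumAssembly
open B12RegularSpaces111 (Frame Region StepConsts space space' expI grad CondIV)
open B12Eq18Current (ofBackground current)
open B12Lemma4ConcreteFrame (JInputs Lemma4Data frameOf LettersAnalyticAt lemma4Printed_frameOf)
open B12Lemma4Models (slProj slProj_mem_suModel_gc suModel_heGc suModel_hgc_Gc slProj_conj)
open B12RegularSpaces111SpecialUnitary (suModel)
open B12Eq311CurrentExpansion (C311)
open Step B14DomainGeom B14.Eq213MaximalDomains B15Eq112TorusCover TreeLengthTorus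
open scoped Matrix.Norms.L2Operator

/-! ## §0. The fundamental-case inputs of Lemma 4 at the data of record as ONE displayed record; transport to the package; the faces at the residual layer -/

section Fundamental

variable {P : Params} {N M : ℕ}

/-- **THE FUNDAMENTAL-CASE INPUTS OF LEMMA 4 AT THE DATA OF RECORD** (a `Type`: the `JInputs` carry the [15]-functions as data) — exactly the binders of dag-n09-c's
`b12LeafOfRecord_of_fundamental`: print's fundamental case `X ⊂ □̃²` for the run's instance (site sets; the seven region inclusions of the package are then THEOREMS,
dag-n09-c §2), the seven further restrictions on the constants (`Cπ = 2`), THE BY-REFERENCE PACKAGE `JInputs` ([15], [14]: the upper-space datum (3.40), `𝐇_j(□₀, Q(…))`,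
`H_{1,j}`, `ℓ`, the gauge transformations with their costs, the identities (3.39)+(3.37) ∕ (3.42) ∕ (3.38)×2 and the sizes (3.37), (3.45)×2, (3.50), (J2)×2, (J3)) for every
value of the variables in the printed domain, and the analyticity of the letters `𝐊`, `𝐀₂` along analytic families (p. 276 «explicitly given analytic functions of 𝐔»).
A HYPOTHESIS structure (= the companion's `B12Package` with its seven region fields replaced by `hX`); nothing printed is asserted.
[cite: Balaban1987RG1, p.275 («Let us consider at first the fundamental case X ⊂ □̃²»), (3.26)–(3.52) pp.275–280, Lemma 4 p.280; Balaban1985Variational, (174)–(177) pp.305–306, Prop. 9 p.309] -/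
structure B12FundamentalInputs (Rz : Sect2.Residual P (MatA N)) (cB : ℝ) (lam : ResidB12Run P N M) where
  -- print's fundamental case `X ⊂ □̃²` for the instance of the run (site sets)
  hX : lam.idx.XSites ⊆ lam.idx.boxT 2
  -- further restrictions on the constants (p07's `Lemma4Data`, `Cπ = 2`)
  hB : 1 ≤ lam.consts.B₃
  hY : 1 ≤ lam.consts.B₃ ^ 2 * lam.consts.O₁ * lam.consts.M
  hα₁ : 16 * (lam.consts.O₁ * lam.consts.M * lam.consts.α₁) ≤ lam.consts.β
  hL10 : 1 + 10 * lam.consts.β ≤ lam.consts.L ^ 2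
  hB'' : 0 ≤ lam.B₃''
  hres'' : lam.B₃'' * lam.consts.α₃ ≤ lam.consts.β * lam.consts.L⁻¹ ^ 2 * lam.consts.α₀
  hresJ : 4 * ((P.d - 1) * ((2 : ℝ) * C311 1)) * (lam.consts.B₃ ^ 2 * lam.consts.O₁ * lam.consts.M) ^ 2 * lam.consts.α₀ ≤ lam.consts.β
  -- the by-reference package on the printed domain
  inputs : ∀ (Φ : FieldPair P 0 (MatA N)ˣ (MatA N)) (A : PBond P 0 → MatA N) (τ : ℝ) (B' : PBond P 0 → MatA N),
    Φ ∈ space (suModel N) (lam.frameBox Rz) (lam.csBox cB) ((1 + 2 * lam.consts.β) * lam.consts.α₀) ((1 + 2 * lam.consts.β) * lam.consts.α₁) lam.α₀ →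
      A ∈ lam.A331 → 0 ≤ τ → τ ≤ 1 → ‖B'‖ < lam.consts.α₃ →
        JInputs (suModel N) lam.consts (lam.frameX Rz) (lam.frameBox Rz) (lam.csX cB) (lam.csBox cB) lam.regionY (slProj N) lam.idx.η lam.B₃'' lam.α₀
          lam.idx.j τ ‖B'‖ (lam.K Φ A τ) (lam.A₂ Φ A τ B')
  -- analyticity of the letters along analytic families with values in the domain
  hKan : ∀ {E : Type} [NormedAddCommGroup E] [NormedSpace ℂ E] {Φf : E → FieldPair P 0 (MatA N)ˣ (MatA N)} {Af Bf : E → PBond P 0 → MatA N}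
    {e₀ : E} (τ : ℝ), LettersAnalyticAt Φf Af Bf e₀ →
      Φf e₀ ∈ space (suModel N) (lam.frameBox Rz) (lam.csBox cB) ((1 + 2 * lam.consts.β) * lam.consts.α₀) ((1 + 2 * lam.consts.β) * lam.consts.α₁) lam.α₀ →
        Af e₀ ∈ lam.A331 → 0 ≤ τ → τ ≤ 1 → ‖Bf e₀‖ < lam.consts.α₃ → ∀ b, AnalyticAt ℂ (fun e => lam.K (Φf e) (Af e) τ b) e₀
  hA2an : ∀ {E : Type} [NormedAddCommGroup E] [NormedSpace ℂ E] {Φf : E → FieldPair P 0 (MatA N)ˣ (MatA N)} {Af Bf : E → PBond P 0 → MatA N}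
    {e₀ : E} (τ : ℝ), LettersAnalyticAt Φf Af Bf e₀ →
      Φf e₀ ∈ space (suModel N) (lam.frameBox Rz) (lam.csBox cB) ((1 + 2 * lam.consts.β) * lam.consts.α₀) ((1 + 2 * lam.consts.β) * lam.consts.α₁) lam.α₀ →
        Af e₀ ∈ lam.A331 → 0 ≤ τ → τ ≤ 1 → ‖Bf e₀‖ < lam.consts.α₃ → ∀ b, AnalyticAt ℂ (fun e => lam.A₂ (Φf e) (Af e) τ (Bf e) b) e₀

namespace B12FundamentalInputs

variable {Rz : Sect2.Residual P (MatA N)} {cB : ℝ} {lam : ResidB12Run P N M}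

/-- The fundamental case gives `X ⊆ □̃³ = Y` (dag-n09-c's `IdxB12.XSites_subset_boxT_three_of_two`). [cite: Balaban1987RG1, p.275 («X ⊂ □̃²»), (3.37) p.277 («on □̃³»)] -/
theorem hX3 (h : B12FundamentalInputs Rz cB lam) : lam.idx.XSites ⊆ lam.idx.boxT 3 :=
  lam.idx.XSites_subset_boxT_three_of_two h.hX

/-- **TRANSPORT TO THE PACKAGE**: the companion's displayed package `B12Package Rz cB lam` whose seven REGION fields are dag-n09-c's §2 THEOREMS at `X ⊆ □̃³ ⇐ X ⊆ □̃²`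
(two of them unconditional) and whose remaining fields are the inputs, verbatim. [cite: Balaban1987RG1, p.275 («X ⊂ □̃²», «□₀ = □̃⁵»), (1.11)–(1.16) p.262, Lemma 4 p.280] -/
def toPackage (h : B12FundamentalInputs Rz cB lam) : B12Package Rz cB lam where
  hB := h.hB
  hY := h.hY
  hα₁ := h.hα₁
  hL10 := h.hL10
  hB'' := h.hB''
  hres'' := h.hres''
  hresJ := h.hresJ
  hXb := lam.frameX_X_bonds_subset_regionY Rz h.hX3
  hXd := lam.frameX_X_dpairs_subset_regionY Rz h.hX3
  hX₂b := lam.frameX_X₂_bonds_subset_regionY Rz h.hX3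
  hX₂p := lam.frameX_X₂_plaqs_subset_X Rz
  hXp' := lam.frameX_X_plaqs_subset_frameBox_X₂ Rz h.hX3
  hYb' := lam.regionY_bonds_subset_frameBox_X₂ Rz
  hXp := lam.stencil_subset_regionY Rz h.hX3
  inputs := h.inputs
  hKan := fun τ hLe hΦ hA hτ0 hτ1 hB' => h.hKan τ hLe hΦ hA hτ0 hτ1 hB'
  hA2an := fun τ hLe hΦ hA hτ0 hτ1 hB' => h.hA2an τ hLe hΦ hA hτ0 hτ1 hB'

/-- Forgetting the regions: a displayed package together with the fundamental case of the instance gives the fundamental-case inputs (the package's seven region fields are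
then redundant — theorems of `hX`). [cite: Balaban1987RG1, p.275 («the fundamental case X ⊂ □̃²»), Lemma 4 p.280] -/
def ofPackage (L : B12Package Rz cB lam) (hX : lam.idx.XSites ⊆ lam.idx.boxT 2) : B12FundamentalInputs Rz cB lam where
  hX := hX
  hB := L.hB
  hY := L.hY
  hα₁ := L.hα₁
  hL10 := L.hL10
  hB'' := L.hB''
  hres'' := L.hres''
  hresJ := L.hresJ
  inputs := L.inputs
  hKan := fun τ hLe hΦ hA hτ0 hτ1 hB' => L.hKan τ hLe hΦ hA hτ0 hτ1 hB'
  hA2an := fun τ hLe hΦ hA hτ0 hτ1 hB' => L.hA2an τ hLe hΦ hA hτ0 hτ1 hB'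

/-- In the fundamental case the inputs record and the displayed package are equi-inhabited. [cite: Balaban1987RG1, p.275 («the fundamental case X ⊂ □̃²»), Lemma 4 p.280 (bookkeeping)] -/
theorem nonempty_iff_nonempty_package (hX : lam.idx.XSites ⊆ lam.idx.boxT 2) :
    Nonempty (B12FundamentalInputs Rz cB lam) ↔ Nonempty (B12Package Rz cB lam) :=
  ⟨fun ⟨h⟩ => ⟨h.toPackage⟩, fun ⟨L⟩ => ⟨ofPackage L hX⟩⟩

/-- **LEMMA 4 (3.53) AT THE GROUP OF RECORD FROM THE FUNDAMENTAL-CASE INPUTS** — dag-n09-c's closer `b12LeafOfRecord_of_fundamental` BY NAME (hence NODE 00's knit face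
`b12LeafOfRecord_of_package` = p07's `lemma4Printed_frameOf` on `toPackage`).  NOT a discharge of N09: the inputs are hypotheses.
[cite: Balaban1987RG1, Lemma 4 (3.53) p.280, p.275 («Let us consider at first the fundamental case X ⊂ □̃²»)] -/
theorem leaf [NeZero N] (h : B12FundamentalInputs Rz cB lam) (hcB : 0 < cB) : B12LeafOfRecord Rz cB lam :=
  b12LeafOfRecord_of_fundamental Rz hcB lam h.hX h.hB h.hY h.hα₁ h.hL10 h.hB'' h.hres'' h.hresJ h.inputs
    (fun τ hLe hΦ hA hτ0 hτ1 hB' => h.hKan τ hLe hΦ hA hτ0 hτ1 hB') (fun τ hLe hΦ hA hτ0 hτ1 hB' => h.hA2an τ hLe hΦ hA hτ0 hτ1 hB')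

/-- **THE PROVISOS OF THE LAYER FROM THE FUNDAMENTAL-CASE INPUTS** (module A's `B12Provisos`, the displays a count line must carry — ref-C READ-115 (B4)): the package (by
`toPackage`), «all the restrictions» of Lemma 4 at the layer's constants, and `0 ∈ (3.31)` (p. 277 «At first let us take A = 0»).
[cite: Balaban1987RG1, Lemma 4 (3.53) p.280 with (3.26)–(3.52) pp.275–280; (3.31) p.276, p.277] -/
theorem provisos (h : B12FundamentalInputs Rz cB lam) (hr : B12Sec2to5.Lemma4Restrictions lam.consts) (h0 : (0 : PBond P 0 → MatA N) ∈ lam.A331) :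
    B12Provisos Rz cB lam :=
  ⟨⟨h.toPackage⟩, hr, h0⟩

/-- **THE CONCLUSION OF LEMMA 4 OUTRIGHT in the fundamental case at a layer satisfying «all the restrictions»** — the leaf is NOT vacuous there: (3.53) for every `(𝐔, 𝐀, τ, B′)`
of the printed domain, and the analyticity clause (the honest horn of ref-C READ116 (B4): restrictions DISPLAYED AND APPLIED). [cite: Balaban1987RG1, Lemma 4 (3.53) p.280] -/
theorem lemma4_conclusion [NeZero N] (h : B12FundamentalInputs Rz cB lam) (hcB : 0 < cB) (hr : B12Sec2to5.Lemma4Restrictions lam.consts) :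
    (∀ (U : (F12OfRecord Rz cB lam).CfgU) (A : (F12OfRecord Rz cB lam).CfgA) (τ : ℝ) (B' : (F12OfRecord Rz cB lam).CfgB),
        U ∈ (F12OfRecord Rz cB lam).Uprime ((1 + 2 * lam.consts.β) * lam.consts.α₀) ((1 + 2 * lam.consts.β) * lam.consts.α₁) →
          A ∈ (F12OfRecord Rz cB lam).A331 → 0 ≤ τ → τ ≤ 1 → (F12OfRecord Rz cB lam).normB B' < lam.consts.α₃ →
            (F12OfRecord Rz cB lam).comp U A τ B' ∈ (F12OfRecord Rz cB lam).Ucj lam.consts.α₀ lam.consts.α₁) ∧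
      (F12OfRecord Rz cB lam).analyticOn ((1 + 2 * lam.consts.β) * lam.consts.α₀) ((1 + 2 * lam.consts.β) * lam.consts.α₁) lam.consts.α₃ :=
  h.leaf hcB hr

/-- **(3.53) AT `𝐀 = 0` in the fundamental case** (p. 277 «At first let us take A = 0»), given `0 ∈ (3.31)` and the restrictions: module A's `B12Provisos.comp_zero_mem` on
`provisos`. [cite: Balaban1987RG1, Lemma 4 (3.53) p.280, p.277] -/
theorem comp_zero_mem [NeZero N] (h : B12FundamentalInputs Rz cB lam) (hcB : 0 < cB) (hr : B12Sec2to5.Lemma4Restrictions lam.consts)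
    (h0 : (0 : PBond P 0 → MatA N) ∈ lam.A331) (Φ : FieldPair P 0 (MatA N)ˣ (MatA N)) (τ : ℝ) (B' : PBond P 0 → MatA N)
    (hΦ : Φ ∈ space (suModel N) (lam.frameBox Rz) (lam.csBox cB) ((1 + 2 * lam.consts.β) * lam.consts.α₀) ((1 + 2 * lam.consts.β) * lam.consts.α₁) lam.α₀)
    (hτ0 : 0 ≤ τ) (hτ1 : τ ≤ 1) (hB' : ‖B'‖ < lam.consts.α₃) :
    (F12OfRecord Rz cB lam).comp Φ (0 : PBond P 0 → MatA N) τ B' ∈ space' (suModel N) (lam.frameX Rz) (lam.csX cB) lam.consts.α₀ lam.consts.α₁ :=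
  (h.provisos hr h0).comp_zero_mem hcB Φ τ B' hΦ hτ0 hτ1 hB'

end B12FundamentalInputs

end Fundamental

/-! ## §1. At def-T's STAGE 12 (`Record12`): the fundamental-case leaf at ONE named layer; joint satisfiability of the `Prop` binders at every Stage-12 parameter -/

section Stage12

variable (F : T4Family) (N : ℕ) [NeZero N]

/-- `2 ≤ L` on every torus of the family (`Params.hL : Odd L ∧ 1 < L`). [cite: Balaban1987RG1, (0.1) p.251 (bookkeeping)] -/
private theorem two_le_L_P (K : ℕ) : 2 ≤ (F.P K).L := (F.P K).hL.2

omit [NeZero N] in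
/-- **JOINT SATISFIABILITY of the fundamental-case `Prop` binders over a [B12] layer of cube size `M ≥ 1`**, run by run: dag-n09-c's `exists_residB12Run_restrictions` on every
torus of the family (`L ≥ 2`): the fundamental case ∧ `0 ∈ (3.31)` ∧ «all the restrictions» `B12Sec2to5.Lemma4Restrictions` ∧ the seven further restrictions (explicit constants
`B₃ = 1`, `O(1) = 1∕M`, `β = 3∕10`, …; the letters `𝐊 = 𝐀₂ = 0` of the witness are JUNK — a witness for the BINDERS, not objects of print).
[cite: Balaban1987RG1, §3 pp.276–280 («all the restrictions»), Lemma 4 p.280, p.275 («the fundamental case X ⊂ □̃²»)] -/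
theorem exists_residB12_restrictions (M : ℕ) (hM : 1 ≤ M) :
    ∃ lam12 : ResidB12 F N M, ∀ p : B12.RunParams,
      (lam12 p).idx.XSites ⊆ (lam12 p).idx.boxT 2 ∧ (0 : PBond (F.P p.K) 0 → MatA N) ∈ (lam12 p).A331 ∧
        B12Sec2to5.Lemma4Restrictions (lam12 p).consts ∧
        1 ≤ (lam12 p).consts.B₃ ∧ 1 ≤ (lam12 p).consts.B₃ ^ 2 * (lam12 p).consts.O₁ * (lam12 p).consts.M ∧
        16 * ((lam12 p).consts.O₁ * (lam12 p).consts.M * (lam12 p).consts.α₁) ≤ (lam12 p).consts.β ∧ 1 + 10 * (lam12 p).consts.β ≤ (lam12 p).consts.L ^ 2 ∧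
        0 ≤ (lam12 p).B₃'' ∧ (lam12 p).B₃'' * (lam12 p).consts.α₃ ≤ (lam12 p).consts.β * (lam12 p).consts.L⁻¹ ^ 2 * (lam12 p).consts.α₀ ∧
        4 * (((F.P p.K).d - 1) * ((2 : ℝ) * C311 1)) * ((lam12 p).consts.B₃ ^ 2 * (lam12 p).consts.O₁ * (lam12 p).consts.M) ^ 2 * (lam12 p).consts.α₀ ≤
          (lam12 p).consts.β :=
  ⟨fun p => Classical.choose (exists_residB12Run_restrictions (F.P p.K) N M hM (two_le_L_P F p.K)),
    fun p => Classical.choose_spec (exists_residB12Run_restrictions (F.P p.K) N M hM (two_le_L_P F p.K))⟩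

/-- **… AT EVERY ADMISSIBLE STAGE-12 PARAMETER** (cube size `θ.τ9.M ≥ 1` from Stage-9 admissibility): the binders `hX`, `hB`–`hresJ` of `b12LeafOfRecord₁₂_of_fundamental`
together with the restriction antecedent of `Lemma4Printed` and `0 ∈ A331` are not an empty conjunction at any Stage-12 record (the by-reference `JInputs` and the analyticity
binders are data about print's letters and are not touched). [cite: Balaban1987RG1, §3 pp.276–280 («all the restrictions»), Lemma 4 p.280] -/
theorem exists_residB12_restrictions₁₂ (θ : Stage12Params F N) (hθ : θ.Admissible F N) :
    ∃ lam12 : ResidB12 F N θ.τ9.M, ∀ p : B12.RunParams,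
      (lam12 p).idx.XSites ⊆ (lam12 p).idx.boxT 2 ∧ (0 : PBond (F.P p.K) 0 → MatA N) ∈ (lam12 p).A331 ∧
        B12Sec2to5.Lemma4Restrictions (lam12 p).consts ∧
        1 ≤ (lam12 p).consts.B₃ ∧ 1 ≤ (lam12 p).consts.B₃ ^ 2 * (lam12 p).consts.O₁ * (lam12 p).consts.M ∧
        16 * ((lam12 p).consts.O₁ * (lam12 p).consts.M * (lam12 p).consts.α₁) ≤ (lam12 p).consts.β ∧ 1 + 10 * (lam12 p).consts.β ≤ (lam12 p).consts.L ^ 2 ∧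
        0 ≤ (lam12 p).B₃'' ∧ (lam12 p).B₃'' * (lam12 p).consts.α₃ ≤ (lam12 p).consts.β * (lam12 p).consts.L⁻¹ ^ 2 * (lam12 p).consts.α₀ ∧
        4 * (((F.P p.K).d - 1) * ((2 : ℝ) * C311 1)) * ((lam12 p).consts.B₃ ^ 2 * (lam12 p).consts.O₁ * (lam12 p).consts.M) ^ 2 * (lam12 p).consts.α₀ ≤
          (lam12 p).consts.β :=
  exists_residB12_restrictions F N θ.τ9.M hθ.toStage9.2.2.2

/-- **THE LEAF AT A STAGE-12 PARAMETER IN THE FUNDAMENTAL CASE** — the ₁₂ twin of dag-n09-c's `b12LeafOfRecord₁₁_of_fundamental` (explicit binders): `B12LeafOfRecord₁₂ F N θ lam p`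
from Stage-12 admissibility (`0 < O(1)LMB`), the run's instance in the fundamental case `X ⊆ □̃²`, the seven further restrictions on the run's constants, the by-reference
package `JInputs` on the printed domain and the analyticity of the run's letters — dag-n09-c's `b12LeafOfRecord_of_fundamental` at THE NAMED layer `lam p`.  NOT a discharge
of N09. [cite: Balaban1987RG1, Lemma 4 (3.53) p.280, p.275 («the fundamental case X ⊂ □̃²»)] -/
theorem b12LeafOfRecord₁₂_of_fundamental (θ : Stage12Params F N) (hθ : θ.Admissible F N) (lam : ResidB12 F N θ.τ9.M) (p : B12.RunParams)
    (hX : (lam p).idx.XSites ⊆ (lam p).idx.boxT 2)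
    (hB : 1 ≤ (lam p).consts.B₃) (hY : 1 ≤ (lam p).consts.B₃ ^ 2 * (lam p).consts.O₁ * (lam p).consts.M)
    (hα₁ : 16 * ((lam p).consts.O₁ * (lam p).consts.M * (lam p).consts.α₁) ≤ (lam p).consts.β) (hL10 : 1 + 10 * (lam p).consts.β ≤ (lam p).consts.L ^ 2)
    (hB'' : 0 ≤ (lam p).B₃'') (hres'' : (lam p).B₃'' * (lam p).consts.α₃ ≤ (lam p).consts.β * (lam p).consts.L⁻¹ ^ 2 * (lam p).consts.α₀)
    (hresJ : 4 * (((F.P p.K).d - 1) * ((2 : ℝ) * C311 1)) * ((lam p).consts.B₃ ^ 2 * (lam p).consts.O₁ * (lam p).consts.M) ^ 2 * (lam p).consts.α₀ ≤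
      (lam p).consts.β)
    (inputs : ∀ (Φ : FieldPair (F.P p.K) 0 (MatA N)ˣ (MatA N)) (A : PBond (F.P p.K) 0 → MatA N) (τ : ℝ) (B' : PBond (F.P p.K) 0 → MatA N),
      Φ ∈ space (suModel N) ((lam p).frameBox (θ.Rz p.K)) ((lam p).csBox θ.s2.cB) ((1 + 2 * (lam p).consts.β) * (lam p).consts.α₀)
          ((1 + 2 * (lam p).consts.β) * (lam p).consts.α₁) (lam p).α₀ →
        A ∈ (lam p).A331 → 0 ≤ τ → τ ≤ 1 → ‖B'‖ < (lam p).consts.α₃ →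
          JInputs (suModel N) (lam p).consts ((lam p).frameX (θ.Rz p.K)) ((lam p).frameBox (θ.Rz p.K)) ((lam p).csX θ.s2.cB) ((lam p).csBox θ.s2.cB)
            (lam p).regionY (slProj N) (lam p).idx.η (lam p).B₃'' (lam p).α₀ (lam p).idx.j τ ‖B'‖ ((lam p).K Φ A τ) ((lam p).A₂ Φ A τ B'))
    (hKan : ∀ {E : Type} [NormedAddCommGroup E] [NormedSpace ℂ E] {Φf : E → FieldPair (F.P p.K) 0 (MatA N)ˣ (MatA N)}
      {Af Bf : E → PBond (F.P p.K) 0 → MatA N} {e₀ : E} (τ : ℝ), LettersAnalyticAt Φf Af Bf e₀ →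
        Φf e₀ ∈ space (suModel N) ((lam p).frameBox (θ.Rz p.K)) ((lam p).csBox θ.s2.cB) ((1 + 2 * (lam p).consts.β) * (lam p).consts.α₀)
            ((1 + 2 * (lam p).consts.β) * (lam p).consts.α₁) (lam p).α₀ →
          Af e₀ ∈ (lam p).A331 → 0 ≤ τ → τ ≤ 1 → ‖Bf e₀‖ < (lam p).consts.α₃ → ∀ b, AnalyticAt ℂ (fun e => (lam p).K (Φf e) (Af e) τ b) e₀)
    (hA2an : ∀ {E : Type} [NormedAddCommGroup E] [NormedSpace ℂ E] {Φf : E → FieldPair (F.P p.K) 0 (MatA N)ˣ (MatA N)}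
      {Af Bf : E → PBond (F.P p.K) 0 → MatA N} {e₀ : E} (τ : ℝ), LettersAnalyticAt Φf Af Bf e₀ →
        Φf e₀ ∈ space (suModel N) ((lam p).frameBox (θ.Rz p.K)) ((lam p).csBox θ.s2.cB) ((1 + 2 * (lam p).consts.β) * (lam p).consts.α₀)
            ((1 + 2 * (lam p).consts.β) * (lam p).consts.α₁) (lam p).α₀ →
          Af e₀ ∈ (lam p).A331 → 0 ≤ τ → τ ≤ 1 → ‖Bf e₀‖ < (lam p).consts.α₃ → ∀ b, AnalyticAt ℂ (fun e => (lam p).A₂ (Φf e) (Af e) τ (Bf e) b) e₀) :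
    B12LeafOfRecord₁₂ F N θ lam p :=
  b12LeafOfRecord_of_fundamental (θ.Rz p.K) hθ.pos.1 (lam p) hX hB hY hα₁ hL10 hB'' hres'' hresJ inputs
    (fun τ hLe hΦ hA hτ0 hτ1 hB' => hKan τ hLe hΦ hA hτ0 hτ1 hB') (fun τ hLe hΦ hA hτ0 hτ1 hB' => hA2an τ hLe hΦ hA hτ0 hτ1 hB')

/-- **THE SAME, RECORD-KEYED**: the Stage-12 leaf of THE NAMED layer `lam p` from Stage-12 admissibility and its fundamental-case inputs (§0's `leaf`).  NOT a discharge of N09.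
[cite: Balaban1987RG1, Lemma 4 (3.53) p.280, p.275 («the fundamental case X ⊂ □̃²»)] -/
theorem b12LeafOfRecord₁₂_of_fundamentalInputs (θ : Stage12Params F N) (hθ : θ.Admissible F N) (lam : ResidB12 F N θ.τ9.M) (p : B12.RunParams)
    (h : B12FundamentalInputs (θ.Rz p.K) θ.s2.cB (lam p)) : B12LeafOfRecord₁₂ F N θ lam p :=
  h.leaf hθ.pos.1

/-- … and the layer's provisos (module A's `B12Provisos`) from the inputs, «all the restrictions» and `0 ∈ (3.31)` — so module A's `_of_provisos` faces and proviso-carrying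
records apply to the named layer. [cite: Balaban1987RG1, Lemma 4 (3.53) p.280; (3.31) p.276, p.277] -/
theorem b12Provisos₁₂_of_fundamentalInputs (θ : Stage12Params F N) (lam : ResidB12 F N θ.τ9.M) (p : B12.RunParams)
    (h : B12FundamentalInputs (θ.Rz p.K) θ.s2.cB (lam p)) (hr : B12Sec2to5.Lemma4Restrictions (lam p).consts)
    (h0 : (0 : PBond (F.P p.K) 0 → MatA N) ∈ (lam p).A331) : B12Provisos (θ.Rz p.K) θ.s2.cB (lam p) :=
  h.provisos hr h0

end Stage12

/-! ## §2. θ-explicit named-λ₁₂ world faces in the fundamental case (the presenting slots are arguments; ONE named layer, no record predicate) -/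

section WorldFaces

variable (F : T4Family) (N : ℕ) [NeZero N]

/-- **`b12` AT A WORLD PRESENTING THE SIX-PIN S-BINDING OF A NAMED `(θ, lam12, lam, M⋆, ops, ζ, lamW)`, IN THE FUNDAMENTAL CASE**: from Stage-12 admissibility and the
fundamental-case inputs of THE NAMED layer `lam12 P` (module A's `_of_leaf` face on §0's `leaf`) — the honest re-key of dag-n09-c's :398 (ONE layer, not all).  NOT a
discharge of N09. [cite: Balaban1987RG1, Lemma 4 (3.53) p.280 (the node's conjunct 1, bookkeeping), p.275 («the fundamental case X ⊂ □̃²»)] -/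
theorem b12_leaf_of_up_view₁₂B12B8B10YZW_of_fundamental (θ : Stage12Params F N) (hθ : θ.Admissible F N) (lam12 : ResidB12 F N θ.τ9.M)
    (lam : ResidB8 θ.toStage3Params) (Mstar : ℕ) (ops : OpsY N θ.toStage3Params Mstar) (ζ : ResidZ F N) (lamW : ResidW F N) {w : WorldP} {P : B12.RunParams}
    (hup : w.up P = upOfRecord₅CS F N (θ.view₁₂B12B8B10YZW F N lam12 lam Mstar ops ζ lamW) P) (h : B12FundamentalInputs (θ.Rz P.K) θ.s2.cB (lam12 P)) :
    (leavesP w P).b12 :=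
  b12_leaf_of_up_view₁₂B12B8B10YZW_of_leaf F N θ lam12 lam Mstar ops ζ lamW hup (h.leaf hθ.pos.1)

/-- **The same at the six-pin view WITH [B8′]** ([B8] over the sub-index of record). NOT a discharge of N09.
[cite: Balaban1987RG1, Lemma 4 (3.53) p.280 (the node's conjunct 1, bookkeeping), p.275 («the fundamental case X ⊂ □̃²»)] -/
theorem b12_leaf_of_up_view₁₂B12B8subB10YZW_of_fundamental (θ : Stage12Params F N) (hθ : θ.Admissible F N) (lam12 : ResidB12 F N θ.τ9.M)
    (lam : ResidB8 θ.toStage3Params) (Mstar : ℕ) (ops : OpsY N θ.toStage3Params Mstar) (ζ : ResidZ F N) (lamW : ResidW F N) {w : WorldP} {P : B12.RunParams}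
    (hup : w.up P = upOfRecord₅CS F N (θ.view₁₂B12B8subB10YZW F N lam12 lam Mstar ops ζ lamW) P) (h : B12FundamentalInputs (θ.Rz P.K) θ.s2.cB (lam12 P)) :
    (leavesP w P).b12 :=
  b12_leaf_of_up_view₁₂B12B8subB10YZW_of_leaf F N θ lam12 lam Mstar ops ζ lamW hup (h.leaf hθ.pos.1)

end WorldFaces

/-! ## §3. Module A's proviso-carrying successor records BUILT FROM fundamental-case inputs at every run (venue (i); GAP-STATED(package) by construction) -/

section ProvisoRecords

variable (F : T4Family) (N : ℕ) [NeZero N]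

/-- **A record of `IsRecordOfRecord₁₂CB10YZWB8B12Prov` FROM FUNDAMENTAL-CASE INPUTS**: given `Provisos₁₂`, admissibility, the named slots, and — at every run — the
fundamental-case inputs of the [B12] layer, «all the restrictions» and `0 ∈ (3.31)`, there is a world with any window `0 < γw ≤ θ.γ` presenting module A's proviso-carrying
record at the datum of record (module A's `exists_world_…Prov` on §0's `provisos`).  STATUS: a PROVISO-CARRYING SUCCESSOR record, NOT the world of record; count-neutral.
[cite: Balaban1989LargeFieldII, Thm 1 + (0.1) pp.355–356 (bookkeeping); Balaban1987RG1, Lemma 4 (3.53) p.280, p.275 («the fundamental case X ⊂ □̃²»)] -/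
theorem exists_world_isRecordOfRecord₁₂CB10YZWB8B12Prov_of_fundamental (θ : Stage12Params F N) (hP : θ.Provisos₁₂ F N) (hθ : θ.Admissible F N)
    (lam12 : ResidB12 F N θ.τ9.M) (lam : ResidB8 θ.toStage3Params) (Mstar : ℕ) (ops : OpsY N θ.toStage3Params Mstar) (ζ : ResidZ F N) (lamW : ResidW F N)
    (hF : ∀ P : B12.RunParams, B12FundamentalInputs (θ.Rz P.K) θ.s2.cB (lam12 P)) (hr : ∀ P : B12.RunParams, B12Sec2to5.Lemma4Restrictions (lam12 P).consts)
    (h0 : ∀ P : B12.RunParams, (0 : PBond (F.P P.K) 0 → MatA N) ∈ (lam12 P).A331) {γw : ℝ} (hγw : 0 < γw ∧ γw ≤ θ.γ) :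
    ∃ w : WorldP, IsRecordOfRecord₁₂CB10YZWB8B12Prov F N (datumOfRecord₁₂ F N θ hP) w ∧ w.γ = γw :=
  exists_world_isRecordOfRecord₁₂CB10YZWB8B12Prov F N θ hP hθ lam12 lam Mstar ops ζ lamW (fun P => (hF P).provisos (hr P) (h0 P)) hγw

/-- **The same for `IsRecordOfRecord₁₂CB10YZWB8subB12Prov`** (the six-pin view with [B8′]).  STATUS: a PROVISO-CARRYING SUCCESSOR record, NOT the world of record; count-neutral.
[cite: Balaban1989LargeFieldII, Thm 1 + (0.1) pp.355–356 (bookkeeping); Balaban1987RG1, Lemma 4 (3.53) p.280, p.275 («the fundamental case X ⊂ □̃²»)] -/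
theorem exists_world_isRecordOfRecord₁₂CB10YZWB8subB12Prov_of_fundamental (θ : Stage12Params F N) (hP : θ.Provisos₁₂ F N) (hθ : θ.Admissible F N)
    (lam12 : ResidB12 F N θ.τ9.M) (lam : ResidB8 θ.toStage3Params) (Mstar : ℕ) (ops : OpsY N θ.toStage3Params Mstar) (ζ : ResidZ F N) (lamW : ResidW F N)
    (hF : ∀ P : B12.RunParams, B12FundamentalInputs (θ.Rz P.K) θ.s2.cB (lam12 P)) (hr : ∀ P : B12.RunParams, B12Sec2to5.Lemma4Restrictions (lam12 P).consts)
    (h0 : ∀ P : B12.RunParams, (0 : PBond (F.P P.K) 0 → MatA N) ∈ (lam12 P).A331) {γw : ℝ} (hγw : 0 < γw ∧ γw ≤ θ.γ) :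
    ∃ w : WorldP, IsRecordOfRecord₁₂CB10YZWB8subB12Prov F N (datumOfRecord₁₂ F N θ hP) w ∧ w.γ = γw :=
  exists_world_isRecordOfRecord₁₂CB10YZWB8subB12Prov F N θ hP hθ lam12 lam Mstar ops ζ lamW (fun P => (hF P).provisos (hr P) (h0 P)) hγw

/-- **… and AT SUCH A WORLD N09's CONJUNCT 1 HOLDS AT EVERY RUN** — because the record DISPLAYS the package at the presenting layer (module A's
`b12_leaf_of_isRecordOfRecord₁₂CB10YZWB8B12Prov`; GAP-STATED(package) by construction; NOT a discharge of N09, count-neutral).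
[cite: Balaban1987RG1, Lemma 4 (3.53) p.280 (the node's conjunct 1, bookkeeping); Balaban1989LargeFieldII, Thm 1 + (0.1) pp.355–356 (bookkeeping)] -/
theorem exists_world_b12_of_fundamental (θ : Stage12Params F N) (hP : θ.Provisos₁₂ F N) (hθ : θ.Admissible F N)
    (lam12 : ResidB12 F N θ.τ9.M) (lam : ResidB8 θ.toStage3Params) (Mstar : ℕ) (ops : OpsY N θ.toStage3Params Mstar) (ζ : ResidZ F N) (lamW : ResidW F N)
    (hF : ∀ P : B12.RunParams, B12FundamentalInputs (θ.Rz P.K) θ.s2.cB (lam12 P)) (hr : ∀ P : B12.RunParams, B12Sec2to5.Lemma4Restrictions (lam12 P).consts)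
    (h0 : ∀ P : B12.RunParams, (0 : PBond (F.P P.K) 0 → MatA N) ∈ (lam12 P).A331) {γw : ℝ} (hγw : 0 < γw ∧ γw ≤ θ.γ) :
    ∃ w : WorldP, IsRecordOfRecord₁₂CB10YZWB8B12Prov F N (datumOfRecord₁₂ F N θ hP) w ∧ w.γ = γw ∧ ∀ P : B12.RunParams, (leavesP w P).b12 := by
  obtain ⟨w, hw, hγ⟩ :=
    exists_world_isRecordOfRecord₁₂CB10YZWB8B12Prov_of_fundamental F N θ hP hθ lam12 lam Mstar ops ζ lamW hF hr h0 hγw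
  exact ⟨w, hw, hγ, b12_leaf_of_isRecordOfRecord₁₂CB10YZWB8B12Prov hw⟩

end ProvisoRecords

/-! ## §4. Kernel negatives (DISPLAY ONLY — consumed by no face above): why dag-n09-c's ∀-over-presenting-layers binder shape is not re-filed at Stage 12 -/

section Negatives

variable {F : T4Family} {N : ℕ} [NeZero N]
variable {D : FiniteEpsData F (SU N)} {w : WorldP}

/-- **THE ∀-OVER-LAYERS FUNDAMENTAL-INPUTS BINDER TYPE IS EMPTY AT EVERY STAGE-12 RECORD** (the ₁₂ shape of dag-n09-c's :398 binders `hX hR inputs hKan hA2an`, bundled): a `₁₂C`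
record presents SOME admissible `(θ, hP)` with `D = datumOfRecord₁₂ θ hP`, at which such a binder would give — through `toPackage` — a package at EVERY layer, against module
A's `isEmpty_forallPackageBinder₁₂_of_isRecordOfRecord₁₂C` (the zero layer).  So NO `…_of_fundamental` face with this binder is typed at Stage 12 (it would conclude from an
empty type); every face above is keyed on ONE NAMED `(θ, λ₁₂)`. [cite: Balaban1989LargeFieldII, Thm 1 + (0.1) pp.355–356 (bookkeeping: the typed record, not print)] -/
theorem isEmpty_forallFundamentalBinder₁₂_of_isRecordOfRecord₁₂C (h : IsRecordOfRecord₁₂C F N D w) :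
    IsEmpty (∀ (θ : Stage12Params F N) (hP : θ.Provisos₁₂ F N) (lam12 : ResidB12 F N θ.τ9.M), θ.Admissible F N → D = datumOfRecord₁₂ F N θ hP →
      ∀ P : B12.RunParams, B12FundamentalInputs (θ.Rz P.K) θ.s2.cB (lam12 P)) :=
  ⟨fun hL => (isEmpty_forallPackageBinder₁₂_of_isRecordOfRecord₁₂C h).false fun θ hP lam12 hθ hD P => (hL θ hP lam12 hθ hD P).toPackage⟩

/-- **ALREADY THE ∀-OVER-LAYERS RESTRICTION BINDER IS FALSE AT EVERY STAGE-12 RECORD** (the ₁₂ shape of dag-n09-c's :398 binder `hR`, first conjunct `1 ≤ B₃`): at the presented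
`(θ, hP)` it would give `1 ≤ B₃` for module A's ZERO LAYER (`B₃ := 0`) of an inhabitant of g32's `ResidB12`, at the run `⟨0, 0, 0⟩`.
[cite: Balaban1987RG1, (3.37) p.277 (bookkeeping: the typed restriction `1 ≤ B₃`, not print); Balaban1989LargeFieldII, Thm 1 + (0.1) pp.355–356 (bookkeeping)] -/
theorem not_forallRestrictionBinder₁₂_of_isRecordOfRecord₁₂C (h : IsRecordOfRecord₁₂C F N D w) :
    ¬ ∀ (θ : Stage12Params F N) (hP : θ.Provisos₁₂ F N) (lam12 : ResidB12 F N θ.τ9.M), θ.Admissible F N → D = datumOfRecord₁₂ F N θ hP →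
      ∀ P : B12.RunParams, 1 ≤ (lam12 P).consts.B₃ := by
  obtain ⟨θ, hP, hθ, hD, -⟩ := h
  intro hR
  obtain ⟨lam12⟩ := nonempty_residB12 (F := F) (N := N) θ.τ9.M
  have h1 : (1 : ℝ) ≤ 0 := hR θ hP (fun P => (lam12 P).zeroLayer) hθ hD ⟨0, 0, 0⟩
  norm_num at h1

end Negatives

end Literature.MathematicalPhysics.QuantumFieldTheory.Balaban1983to89.Node00

end
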